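import Summits.HubbardSuperconductivity.HubbardSuperconductivity.Theorems.ThermalWedgeTwSeededEnsembleEquivalenceROptimiserFloor
import Summits.HubbardSuperconductivity.HubbardSuperconductivity.Theorems.TwSourcedCondensation.Negative.SourceResponseStructure

/-!
# Crux `TwSeededEnsembleEquivalenceR` (stmt-HubbardSuperconductivity-15581), line `cold-floor-collapse`
# (slug `Sketch`), skeleton v8.1 (block two-phase pinning) — registered stub `stub_noSplitGlue`:
# FLOOR + DEEP-UNIQ′ ⟹ NoSplit

Support file (`--supports stmt-HubbardSuperconductivity-15581`; sorry-free; no definition; route-file free).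

`q` = pointwise thermodynamic limit of the cold sourced torus pressure on `[μ₁, μ₂] × [−R, R]` (`R = 13g+1`),
`G(μ,h) = q μ h − h²/g` the AHM payoff, `B = sup_{|h| ≤ R} G(·,h)`. **NoSplit** (input of the two-phase closure
of skeleton v8): at interior `μ` every subgradient `ν` of `B` on the window is a subgradient of `q(·,h₀)` for
SOME maximiser `h₀`. Derived from FLOOR (type of the landed `stub_optimiserFloor hC`: maximisers are deep,
`e^{−a/(4U)} ≤ |h|`) and DEEP-UNIQ′ (registered physics stub `stub_sourcedColdUniqDeep`: deep maximisers at
interior `μ` lie in `{h*, −h*}`), with `a := min a₁ a₂`, `K' := max`, `U₀ := min` (bookkeeping of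
`stub_deepGlue`). Evenness (`partitionFn_dWaveSourceTorus_neg`), the `8√2` / `2` Lipschitz bounds and the
`μ`-convexity of the finite-volume pressure pass to `q`, so ALL maximisers at `μ` share one `μ`-profile.
Real analysis (`nsg_right_transfer`): `μₙ ↓ μ`, maximisers `hₙ → h̄` along a subsequence (compact box), `h̄`
a maximiser at `μ`; for `μ < μₙ < μ'`: `ν(μₙ − μ) ≤ B(μₙ) − B(μ) ≤ q(μₙ,hₙ) − q(μ,hₙ)` (subgradient; `G(·,hₙ)`
touches `B` from below at `μₙ`), the three-chord inequality for the convex `q(·,hₙ)` gives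
`ν(μ' − μₙ) ≤ q(μ',hₙ) − q(μₙ,hₙ)`, and `n → ∞`. Symmetrically from the left; the common profile glues the
two half-lines. [folklore composition; Hiriart-Urruty–Lemaréchal, Convex Analysis and Minimization
Algorithms I, §VI.4.4]
-/

-- the summit path `HubbardSuperconductivity/HubbardSuperconductivity` forces a duplicated namespace segment
set_option linter.dupNamespace false

namespace Summit.HubbardSuperconductivity.HubbardSuperconductivity.Theorems.TwSeededEnsembleEquivalenceR.ColdFloorLine

open Matrix Filter Topology Literature.MathematicalPhysics.QuantumLattice
open Summit.HubbardSuperconductivity.HubbardSuperconductivity.Theorems.TwSourcedCondensation.Negative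
open scoped ComplexOrder

noncomputable section

/-! ### Pure real analysis: limits of maximisers and one-sided subgradient transfer -/

/-- **Joint convergence along sequences** `q μₙ hₙ → q μ h̄` for `μₙ → μ` in the window and `hₙ → h̄` in
the box, from the two Lipschitz bounds of `q` (in `h` uniformly on the window, in `μ` on the window).
[folklore] -/
theorem nsg_tendsto_of_lipschitz {q : ℝ → ℝ → ℝ} {μ₁ μ₂ R Cμ Ch : ℝ}
    (hLh : ∀ μ' ∈ Set.Icc μ₁ μ₂, ∀ h ∈ Set.Icc (-R) R, ∀ h' ∈ Set.Icc (-R) R,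
      |q μ' h - q μ' h'| ≤ Ch * |h - h'|)
    (hLμ : ∀ h ∈ Set.Icc (-R) R, ∀ μ' ∈ Set.Icc μ₁ μ₂, ∀ μ'' ∈ Set.Icc μ₁ μ₂,
      |q μ' h - q μ'' h| ≤ Cμ * |μ' - μ''|)
    {μs hs : ℕ → ℝ} {μ hbar : ℝ} (hμsW : ∀ n, μs n ∈ Set.Icc μ₁ μ₂) (hμW : μ ∈ Set.Icc μ₁ μ₂)
    (hhsS : ∀ n, hs n ∈ Set.Icc (-R) R) (hbarS : hbar ∈ Set.Icc (-R) R)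
    (hμs : Tendsto μs atTop (𝓝 μ)) (hhs : Tendsto hs atTop (𝓝 hbar)) :
    Tendsto (fun n => q (μs n) (hs n)) atTop (𝓝 (q μ hbar)) := by
  have hmaj : Tendsto (fun n => Ch * |hs n - hbar| + Cμ * |μs n - μ|) atTop (𝓝 0) := by
    have ha : Tendsto (fun n => hs n - hbar) atTop (𝓝 0) := by
      simpa using hhs.sub_const hbar
    have hb : Tendsto (fun n => μs n - μ) atTop (𝓝 0) := by
      simpa using hμs.sub_const μ
    simpa using (ha.abs.const_mul Ch).add (hb.abs.const_mul Cμ)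
  refine tendsto_sub_nhds_zero_iff.1 (squeeze_zero_norm (fun n => ?_) hmaj)
  rw [Real.norm_eq_abs]
  calc |q (μs n) (hs n) - q μ hbar|
      = |(q (μs n) (hs n) - q (μs n) hbar) + (q (μs n) hbar - q μ hbar)| := by
        congr 1; ring
    _ ≤ |q (μs n) (hs n) - q (μs n) hbar| + |q (μs n) hbar - q μ hbar| := abs_add_le _ _
    _ ≤ Ch * |hs n - hbar| + Cμ * |μs n - μ| :=
        add_le_add (hLh _ (hμsW n) _ (hhsS n) _ hbarS) (hLμ _ hbarS _ (hμsW n) _ hμW)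

/-- **Limits of maximisers are maximisers.** For `μₙ → μ` in the window pick maximisers `hₙ` of the
payoff `h ↦ q μₙ h − h²/g` over the box (they exist: `B` is attained); a subsequence converges to some `h̄`
in the compact box, `h̄` is a maximiser at `μ`, and `q(μ', h_{φ n}) → q(μ', h̄)` on the window as well as
`q(μ_{φ n}, h_{φ n}) → q(μ, h̄)`. [folklore] -/
theorem nsg_limit_maximiser {q : ℝ → ℝ → ℝ} {B : ℝ → ℝ} {μ₁ μ₂ R Cμ Ch : ℝ} (g : ℝ)
    (hLh : ∀ μ' ∈ Set.Icc μ₁ μ₂, ∀ h ∈ Set.Icc (-R) R, ∀ h' ∈ Set.Icc (-R) R,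
      |q μ' h - q μ' h'| ≤ Ch * |h - h'|)
    (hLμ : ∀ h ∈ Set.Icc (-R) R, ∀ μ' ∈ Set.Icc μ₁ μ₂, ∀ μ'' ∈ Set.Icc μ₁ μ₂,
      |q μ' h - q μ'' h| ≤ Cμ * |μ' - μ''|)
    (hBup : ∀ μ' ∈ Set.Icc μ₁ μ₂, ∀ h ∈ Set.Icc (-R) R, q μ' h - h ^ 2 / g ≤ B μ')
    (hBatt : ∀ μ' ∈ Set.Icc μ₁ μ₂, ∃ h ∈ Set.Icc (-R) R, q μ' h - h ^ 2 / g = B μ')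
    {μs : ℕ → ℝ} {μ : ℝ} (hμsW : ∀ n, μs n ∈ Set.Icc μ₁ μ₂) (hμW : μ ∈ Set.Icc μ₁ μ₂)
    (hμs : Tendsto μs atTop (𝓝 μ)) :
    ∃ hbar ∈ Set.Icc (-R) R, ∃ φ : ℕ → ℕ, ∃ hs : ℕ → ℝ, StrictMono φ ∧
      (∀ n, hs n ∈ Set.Icc (-R) R) ∧ (∀ n, q (μs (φ n)) (hs n) - hs n ^ 2 / g = B (μs (φ n))) ∧
      q μ hbar - hbar ^ 2 / g = B μ ∧
      Tendsto (fun n => q (μs (φ n)) (hs n)) atTop (𝓝 (q μ hbar)) ∧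
      ∀ μ' ∈ Set.Icc μ₁ μ₂, Tendsto (fun n => q μ' (hs n)) atTop (𝓝 (q μ' hbar)) := by
  choose hs hhsS hhs_eq using fun n => hBatt (μs n) (hμsW n)
  obtain ⟨hbar, hbarS, φ, hφ, hlim⟩ := isCompact_Icc.tendsto_subseq (x := hs) fun n => hhsS n
  have hμs' : Tendsto (fun n => μs (φ n)) atTop (𝓝 μ) := hμs.comp hφ.tendsto_atTop
  have hT : Tendsto (fun n => q (μs (φ n)) (hs (φ n))) atTop (𝓝 (q μ hbar)) :=
    nsg_tendsto_of_lipschitz hLh hLμ (fun n => hμsW (φ n)) hμW (fun n => hhsS (φ n)) hbarS hμs' hlim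
  have hT' : ∀ μ' ∈ Set.Icc μ₁ μ₂, Tendsto (fun n => q μ' (hs (φ n))) atTop (𝓝 (q μ' hbar)) :=
    fun μ' hμ' => nsg_tendsto_of_lipschitz hLh hLμ (fun _ => hμ') hμ' (fun n => hhsS (φ n)) hbarS
      tendsto_const_nhds hlim
  -- `h̄` maximises the payoff at `μ`
  have hmax : ∀ h' ∈ Set.Icc (-R) R, q μ h' - h' ^ 2 / g ≤ q μ hbar - hbar ^ 2 / g := by
    intro h' hh'
    have ha : Tendsto (fun n => q (μs (φ n)) h' - h' ^ 2 / g) atTop (𝓝 (q μ h' - h' ^ 2 / g)) :=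
      (nsg_tendsto_of_lipschitz hLh hLμ (fun n => hμsW (φ n)) hμW (fun _ => hh') hh' hμs'
        tendsto_const_nhds).sub_const _
    have hb : Tendsto (fun n => q (μs (φ n)) (hs (φ n)) - hs (φ n) ^ 2 / g) atTop
        (𝓝 (q μ hbar - hbar ^ 2 / g)) := hT.sub ((hlim.pow 2).div_const g)
    exact le_of_tendsto_of_tendsto' ha hb fun n =>
      (hBup _ (hμsW (φ n)) h' hh').trans_eq (hhs_eq (φ n)).symm
  refine ⟨hbar, hbarS, φ, fun n => hs (φ n), hφ, fun n => hhsS (φ n), fun n => hhs_eq (φ n), ?_,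
    hT, hT'⟩
  obtain ⟨h₁, hh₁S, hh₁eq⟩ := hBatt μ hμW
  exact le_antisymm (hBup μ hμW hbar hbarS) ((le_of_eq hh₁eq.symm).trans (hmax h₁ hh₁S))

/-- **Right subgradient transfer.** `q` convex in `μ` on the window for each `h` in the box, with the two
Lipschitz bounds; `B` the attained envelope of the payoff; `μ` interior and `ν` a subgradient of `B` at `μ`
on the window. Then some maximiser `h̄` at `μ` (a limit of maximisers from the right) has
`q μ h̄ + ν (μ' − μ) ≤ q μ' h̄` for every `μ' > μ` in the window (for `μ < μₙ < μ'`: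
`ν(μₙ − μ) ≤ B(μₙ) − B(μ) ≤ q(μₙ,hₙ) − q(μ,hₙ)`, three-chord inequality, `n → ∞`). [folklore] -/
theorem nsg_right_transfer {q : ℝ → ℝ → ℝ} {B : ℝ → ℝ} {μ₁ μ₂ R Cμ Ch μ ν : ℝ} (g : ℝ)
    (hLh : ∀ μ' ∈ Set.Icc μ₁ μ₂, ∀ h ∈ Set.Icc (-R) R, ∀ h' ∈ Set.Icc (-R) R,
      |q μ' h - q μ' h'| ≤ Ch * |h - h'|)
    (hLμ : ∀ h ∈ Set.Icc (-R) R, ∀ μ' ∈ Set.Icc μ₁ μ₂, ∀ μ'' ∈ Set.Icc μ₁ μ₂,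
      |q μ' h - q μ'' h| ≤ Cμ * |μ' - μ''|)
    (hcvx : ∀ h ∈ Set.Icc (-R) R, ConvexOn ℝ (Set.Icc μ₁ μ₂) fun μ' => q μ' h)
    (hBup : ∀ μ' ∈ Set.Icc μ₁ μ₂, ∀ h ∈ Set.Icc (-R) R, q μ' h - h ^ 2 / g ≤ B μ')
    (hBatt : ∀ μ' ∈ Set.Icc μ₁ μ₂, ∃ h ∈ Set.Icc (-R) R, q μ' h - h ^ 2 / g = B μ')
    (hμ : μ ∈ Set.Ioo μ₁ μ₂) (hν : ∀ μ' ∈ Set.Icc μ₁ μ₂, B μ + ν * (μ' - μ) ≤ B μ') :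
    ∃ h₀ ∈ Set.Icc (-R) R, q μ h₀ - h₀ ^ 2 / g = B μ ∧
      ∀ μ' ∈ Set.Icc μ₁ μ₂, μ < μ' → q μ h₀ + ν * (μ' - μ) ≤ q μ' h₀ := by
  have hμW : μ ∈ Set.Icc μ₁ μ₂ := ⟨hμ.1.le, hμ.2.le⟩
  -- a sequence `μₙ ↓ μ` inside `(μ, μ₂)`
  obtain ⟨μs, -, hμsI, hμs⟩ := exists_seq_strictAnti_tendsto' hμ.2
  have hμsW : ∀ n, μs n ∈ Set.Icc μ₁ μ₂ := fun n =>
    ⟨by linarith [(hμsI n).1, hμ.1], (hμsI n).2.le⟩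
  obtain ⟨hbar, hbarS, φ, hs, hφ, hhsS, hhs_eq, hbar_eq, hT, hT'⟩ :=
    nsg_limit_maximiser g hLh hLμ hBup hBatt hμsW hμW hμs
  refine ⟨hbar, hbarS, hbar_eq, fun μ' hμ' hlt => ?_⟩
  have hμsφ : Tendsto (fun n => μs (φ n)) atTop (𝓝 μ) := hμs.comp hφ.tendsto_atTop
  have hev : ∀ᶠ n in atTop, μs (φ n) < μ' := hμsφ.eventually (eventually_lt_nhds hlt)
  have hineq : ∀ᶠ n in atTop, ν * (μ' - μs (φ n)) ≤ q μ' (hs n) - q (μs (φ n)) (hs n) := by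
    filter_upwards [hev] with n hn
    have hy : μ < μs (φ n) := (hμsI (φ n)).1
    -- subgradient inequality at `μₙ` and touching from below at `μ`: `ν(μₙ − μ) ≤ q(μₙ,hₙ) − q(μ,hₙ)`
    have h1 := hν _ (hμsW (φ n))
    have h2 := hBup μ hμW _ (hhsS n)
    have h3 : ν * (μs (φ n) - μ) ≤ q (μs (φ n)) (hs n) - q μ (hs n) := by
      have h4 := hhs_eq n
      linarith
    -- three-chord inequality for the convex `q(·, hₙ)` at `μ < μₙ < μ'`
    have h4 := (hcvx _ (hhsS n)).slope_mono_adjacent hμW hμ' hy hn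
    have h5 : ν ≤ (q (μs (φ n)) (hs n) - q μ (hs n)) / (μs (φ n) - μ) := by
      rwa [le_div_iff₀ (sub_pos.2 hy)]
    have h6 := h5.trans h4
    rwa [le_div_iff₀ (sub_pos.2 hn)] at h6
  have hlimL : Tendsto (fun n => ν * (μ' - μs (φ n))) atTop (𝓝 (ν * (μ' - μ))) :=
    (tendsto_const_nhds.sub hμsφ).const_mul ν
  have hlimR : Tendsto (fun n => q μ' (hs n) - q (μs (φ n)) (hs n)) atTop
      (𝓝 (q μ' hbar - q μ hbar)) := (hT' μ' hμ').sub hT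
  have := le_of_tendsto_of_tendsto hlimL hlimR hineq
  linarith

/-- **Left subgradient transfer** (mirror image of `nsg_right_transfer`): some maximiser `h̄'` at `μ` (a
limit of maximisers from the left) has `q μ h̄' + ν (μ' − μ) ≤ q μ' h̄'` for every `μ' < μ` in the window.
[folklore] -/
theorem nsg_left_transfer {q : ℝ → ℝ → ℝ} {B : ℝ → ℝ} {μ₁ μ₂ R Cμ Ch μ ν : ℝ} (g : ℝ)
    (hLh : ∀ μ' ∈ Set.Icc μ₁ μ₂, ∀ h ∈ Set.Icc (-R) R, ∀ h' ∈ Set.Icc (-R) R,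
      |q μ' h - q μ' h'| ≤ Ch * |h - h'|)
    (hLμ : ∀ h ∈ Set.Icc (-R) R, ∀ μ' ∈ Set.Icc μ₁ μ₂, ∀ μ'' ∈ Set.Icc μ₁ μ₂,
      |q μ' h - q μ'' h| ≤ Cμ * |μ' - μ''|)
    (hcvx : ∀ h ∈ Set.Icc (-R) R, ConvexOn ℝ (Set.Icc μ₁ μ₂) fun μ' => q μ' h)
    (hBup : ∀ μ' ∈ Set.Icc μ₁ μ₂, ∀ h ∈ Set.Icc (-R) R, q μ' h - h ^ 2 / g ≤ B μ')
    (hBatt : ∀ μ' ∈ Set.Icc μ₁ μ₂, ∃ h ∈ Set.Icc (-R) R, q μ' h - h ^ 2 / g = B μ')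
    (hμ : μ ∈ Set.Ioo μ₁ μ₂) (hν : ∀ μ' ∈ Set.Icc μ₁ μ₂, B μ + ν * (μ' - μ) ≤ B μ') :
    ∃ h₀ ∈ Set.Icc (-R) R, q μ h₀ - h₀ ^ 2 / g = B μ ∧
      ∀ μ' ∈ Set.Icc μ₁ μ₂, μ' < μ → q μ h₀ + ν * (μ' - μ) ≤ q μ' h₀ := by
  have hμW : μ ∈ Set.Icc μ₁ μ₂ := ⟨hμ.1.le, hμ.2.le⟩
  -- a sequence `μₙ ↑ μ` inside `(μ₁, μ)`
  obtain ⟨μs, -, hμsI, hμs⟩ := exists_seq_strictMono_tendsto' hμ.1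
  have hμsW : ∀ n, μs n ∈ Set.Icc μ₁ μ₂ := fun n =>
    ⟨(hμsI n).1.le, by linarith [(hμsI n).2, hμ.2]⟩
  obtain ⟨hbar, hbarS, φ, hs, hφ, hhsS, hhs_eq, hbar_eq, hT, hT'⟩ :=
    nsg_limit_maximiser g hLh hLμ hBup hBatt hμsW hμW hμs
  refine ⟨hbar, hbarS, hbar_eq, fun μ' hμ' hlt => ?_⟩
  have hμsφ : Tendsto (fun n => μs (φ n)) atTop (𝓝 μ) := hμs.comp hφ.tendsto_atTop
  have hev : ∀ᶠ n in atTop, μ' < μs (φ n) := hμsφ.eventually (eventually_gt_nhds hlt)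
  have hineq : ∀ᶠ n in atTop, q (μs (φ n)) (hs n) - q μ' (hs n) ≤ ν * (μs (φ n) - μ') := by
    filter_upwards [hev] with n hn
    have hy : μs (φ n) < μ := (hμsI (φ n)).2
    -- subgradient inequality at `μₙ` and touching from below at `μ`: `q(μ,hₙ) − q(μₙ,hₙ) ≤ ν(μ − μₙ)`
    have h1 := hν _ (hμsW (φ n))
    have h2 := hBup μ hμW _ (hhsS n)
    have h3 : q μ (hs n) - q (μs (φ n)) (hs n) ≤ ν * (μ - μs (φ n)) := by
      have h4 := hhs_eq n
      linarith
    -- three-chord inequality for the convex `q(·, hₙ)` at `μ' < μₙ < μ`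
    have h4 := (hcvx _ (hhsS n)).slope_mono_adjacent hμ' hμW hn hy
    have h5 : (q μ (hs n) - q (μs (φ n)) (hs n)) / (μ - μs (φ n)) ≤ ν := by
      rwa [div_le_iff₀ (sub_pos.2 hy)]
    have h6 := h4.trans h5
    rwa [div_le_iff₀ (sub_pos.2 hn)] at h6
  have hlimL : Tendsto (fun n => q (μs (φ n)) (hs n) - q μ' (hs n)) atTop
      (𝓝 (q μ hbar - q μ' hbar)) := hT.sub (hT' μ' hμ')
  have hlimR : Tendsto (fun n => ν * (μs (φ n) - μ')) atTop (𝓝 (ν * (μ - μ'))) :=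
    (hμsφ.sub tendsto_const_nhds).const_mul ν
  have := le_of_tendsto_of_tendsto hlimL hlimR hineq
  linarith

/-- **NoSplit at one `μ` when all maximisers share one `μ`-profile.** If, in addition to the hypotheses of
the two transfer lemmas, any two maximisers `h, h'` of the payoff at the interior point `μ` have
`q(·,h) = q(·,h')` on the window, then every subgradient `ν` of the envelope `B` at `μ` is a subgradient of
`q(·,h₀)` at `μ` for some maximiser `h₀` (the right-limit maximiser; the left half-line is imported from
the left-limit maximiser through the common profile). [folklore] -/
theorem nsg_noSplitAt_of_uniprofile {q : ℝ → ℝ → ℝ} {B : ℝ → ℝ} {μ₁ μ₂ R Cμ Ch μ ν : ℝ} (g : ℝ)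
    (hLh : ∀ μ' ∈ Set.Icc μ₁ μ₂, ∀ h ∈ Set.Icc (-R) R, ∀ h' ∈ Set.Icc (-R) R,
      |q μ' h - q μ' h'| ≤ Ch * |h - h'|)
    (hLμ : ∀ h ∈ Set.Icc (-R) R, ∀ μ' ∈ Set.Icc μ₁ μ₂, ∀ μ'' ∈ Set.Icc μ₁ μ₂,
      |q μ' h - q μ'' h| ≤ Cμ * |μ' - μ''|)
    (hcvx : ∀ h ∈ Set.Icc (-R) R, ConvexOn ℝ (Set.Icc μ₁ μ₂) fun μ' => q μ' h)
    (hBup : ∀ μ' ∈ Set.Icc μ₁ μ₂, ∀ h ∈ Set.Icc (-R) R, q μ' h - h ^ 2 / g ≤ B μ')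
    (hBatt : ∀ μ' ∈ Set.Icc μ₁ μ₂, ∃ h ∈ Set.Icc (-R) R, q μ' h - h ^ 2 / g = B μ')
    (hμ : μ ∈ Set.Ioo μ₁ μ₂)
    (huni : ∀ h ∈ Set.Icc (-R) R, ∀ h' ∈ Set.Icc (-R) R, q μ h - h ^ 2 / g = B μ →
      q μ h' - h' ^ 2 / g = B μ → ∀ μ' ∈ Set.Icc μ₁ μ₂, q μ' h = q μ' h')
    (hν : ∀ μ' ∈ Set.Icc μ₁ μ₂, B μ + ν * (μ' - μ) ≤ B μ') :
    ∃ h₀ ∈ Set.Icc (-R) R, q μ h₀ - h₀ ^ 2 / g = B μ ∧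
      ∀ μ' ∈ Set.Icc μ₁ μ₂, q μ h₀ + ν * (μ' - μ) ≤ q μ' h₀ := by
  obtain ⟨hP, hPS, hPeq, hright⟩ := nsg_right_transfer g hLh hLμ hcvx hBup hBatt hμ hν
  obtain ⟨hM, hMS, hMeq, hleft⟩ := nsg_left_transfer g hLh hLμ hcvx hBup hBatt hμ hν
  refine ⟨hP, hPS, hPeq, fun μ' hμ' => ?_⟩
  rcases lt_trichotomy μ μ' with hlt | heq | hgt
  · exact hright μ' hμ' hlt
  · subst heq; simp
  · have e1 := huni hM hMS hP hPS hMeq hPeq μ' hμ'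
    have e2 := huni hM hMS hP hPS hMeq hPeq μ ⟨hμ.1.le, hμ.2.le⟩
    have h1 := hleft μ' hμ' hgt
    rw [e1, e2] at h1
    exact h1

/-! ### The model: NoSplit at one `μ` from a `±h*` maximiser set -/

/-- **NoSplit at one chemical potential from a two-point maximiser set (model core).** Fix a torus
coupling `U`, inverse temperature `β > 0`, seed `g`, box `[−R, R]` (`R ≥ 0`), a window `[μ₁, μ₂]` and a
pointwise thermodynamic limit `q` of the sourced torus pressure on `[μ₁, μ₂] × [−R, R]`. If at the interior
point `μ` the maximisers of the payoff `h ↦ q μ h − h²/g` over the box lie in `{h*, −h*}` for some `h*`,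
then every subgradient `ν` (on the window) of `B = sup_{box} [q(·,h) − h²/g]` at `μ` is a subgradient of
`q(·,h₀)` for SOME maximiser `h₀`. Evenness, the `8√2` / `2` Lipschitz bounds and the `μ`-convexity of the
finite-volume pressure pass to the limit, so all maximisers at `μ` share one `μ`-profile and
`nsg_noSplitAt_of_uniprofile` applies. [folklore composition] -/
theorem nsg_noSplitAt_of_pm_uniq (U β g R μ₁ μ₂ : ℝ) (hβ : 0 < β) (hR : 0 ≤ R) (q : ℝ → ℝ → ℝ)
    (hq : ∀ μ ∈ Set.Icc μ₁ μ₂, ∀ h ∈ Set.Icc (-R) R, ∀ κ : ℝ, 0 < κ →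
      ∃ L₀ : ℕ, ∀ (L : ℕ) [NeZero L], L₀ ≤ L →
        |Real.log (Matrix.partitionFn β (dWaveSourceTorus L U μ h)).re / (β * (L : ℝ) ^ 2) - q μ h| ≤ κ)
    {μ : ℝ} (hμ : μ ∈ Set.Ioo μ₁ μ₂)
    (huniq : ∃ hstar : ℝ, ∀ h ∈ Set.Icc (-R) R,
      q μ h - h ^ 2 / g = sSup ((fun h' : ℝ => q μ h' - h' ^ 2 / g) '' Set.Icc (-R) R) →
        h = hstar ∨ h = -hstar)
    {ν : ℝ} (hν : ∀ μ' ∈ Set.Icc μ₁ μ₂,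
      sSup ((fun h' : ℝ => q μ h' - h' ^ 2 / g) '' Set.Icc (-R) R) + ν * (μ' - μ) ≤
        sSup ((fun h' : ℝ => q μ' h' - h' ^ 2 / g) '' Set.Icc (-R) R)) :
    ∃ h₀ ∈ Set.Icc (-R) R,
      q μ h₀ - h₀ ^ 2 / g = sSup ((fun h' : ℝ => q μ h' - h' ^ 2 / g) '' Set.Icc (-R) R) ∧
      ∀ μ' ∈ Set.Icc μ₁ μ₂, q μ h₀ + ν * (μ' - μ) ≤ q μ' h₀ := by
  -- adapted from `nsc_noSplitAt_of_concaveOn` (…RSubgradientSelection.lean): sequence form of the limit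
  have hseq : ∀ μ' ∈ Set.Icc μ₁ μ₂, ∀ h ∈ Set.Icc (-R) R, ∀ κ : ℝ, 0 < κ → ∃ N : ℕ, ∀ n, N ≤ n →
      |Real.log (partitionFn β (dWaveSourceTorus (n + 1) U μ' h)).re / (β * ((n + 1 : ℕ) : ℝ) ^ 2) -
          q μ' h| ≤ κ := by
    intro μ' hμ' h hh κ hκ
    obtain ⟨L₁, hL₁⟩ := hq μ' hμ' h hh κ hκ
    exact ⟨L₁, fun n hn => hL₁ (n + 1) (by omega)⟩
  -- evenness in `h`
  have heven : ∀ μ' ∈ Set.Icc μ₁ μ₂, ∀ h ∈ Set.Icc (-R) R, q μ' (-h) = q μ' h := by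
    intro μ' hμ' h hh
    have hnh : -h ∈ Set.Icc (-R) R := ⟨by linarith [hh.2], by linarith [hh.1]⟩
    have h00 : |q μ' (-h) - q μ' h| ≤ 0 := by
      refine cfb_abs_sub_le_of_limits (hseq μ' hμ' (-h) hnh) (hseq μ' hμ' h hh) fun n => ?_
      rw [partitionFn_dWaveSourceTorus_neg, sub_self, abs_zero]
    have := abs_nonneg (q μ' (-h) - q μ' h)
    linarith [abs_le.mp h00]
  -- Lipschitz bounds of the limit: `8√2` in `h`, `2` in `μ`
  have hLh : ∀ μ' ∈ Set.Icc μ₁ μ₂, ∀ h ∈ Set.Icc (-R) R, ∀ h' ∈ Set.Icc (-R) R,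
      |q μ' h - q μ' h'| ≤ 8 * Real.sqrt 2 * |h - h'| := by
    intro μ' hμ' h hh h' hh'
    refine cfb_abs_sub_le_of_limits (hseq μ' hμ' h hh) (hseq μ' hμ' h' hh') fun n => ?_
    exact abs_sourcedPressure_sub_le (n + 1) U μ' hβ h h'
  have hLμ : ∀ h ∈ Set.Icc (-R) R, ∀ μ' ∈ Set.Icc μ₁ μ₂, ∀ μ'' ∈ Set.Icc μ₁ μ₂,
      |q μ' h - q μ'' h| ≤ 2 * |μ' - μ''| := by
    intro h hh μ' hμ' μ'' hμ''
    refine cfb_abs_sub_le_of_limits (hseq μ' hμ' h hh) (hseq μ'' hμ'' h hh) fun n => ?_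
    exact cfb_abs_sourcedPressure_sub_mu_le (n + 1) U h hβ μ' μ''
  -- convexity in `μ` of the limit
  have hcvx : ∀ h ∈ Set.Icc (-R) R, ConvexOn ℝ (Set.Icc μ₁ μ₂) (fun μ' => q μ' h) := by
    intro h hh
    refine cfc_convexOn_of_limit (convex_Icc μ₁ μ₂)
      (f := fun n μ' => Real.log (partitionFn β (dWaveSourceTorus (n + 1) U μ' h)).re /
        (β * ((n + 1 : ℕ) : ℝ) ^ 2)) (fun n => ?_) (fun μ' hμ' κ hκ => hseq μ' hμ' h hh κ hκ)
    exact (cfb_convexOn_sourcedPressure (n + 1) U h hβ).subset (Set.subset_univ _) (convex_Icc μ₁ μ₂)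
  -- the envelope is attained and bounds the payoff (extreme value theorem on the box)
  have hB : ∀ μ' ∈ Set.Icc μ₁ μ₂, ∃ hb ∈ Set.Icc (-R) R,
      (∀ h' ∈ Set.Icc (-R) R, q μ' h' - h' ^ 2 / g ≤ q μ' hb - hb ^ 2 / g) ∧
        sSup ((fun h' : ℝ => q μ' h' - h' ^ 2 / g) '' Set.Icc (-R) R) = q μ' hb - hb ^ 2 / g :=
    fun μ' hμ' => danskin_exists_max (fun _ h => q μ' h) g hR (fun _ => hLh μ' hμ') μ'
  have hBatt : ∀ μ' ∈ Set.Icc μ₁ μ₂, ∃ h ∈ Set.Icc (-R) R,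
      q μ' h - h ^ 2 / g = sSup ((fun h' : ℝ => q μ' h' - h' ^ 2 / g) '' Set.Icc (-R) R) := by
    intro μ' hμ'
    obtain ⟨hb, hbS, -, hsup⟩ := hB μ' hμ'
    exact ⟨hb, hbS, hsup.symm⟩
  have hBup : ∀ μ' ∈ Set.Icc μ₁ μ₂, ∀ h ∈ Set.Icc (-R) R,
      q μ' h - h ^ 2 / g ≤ sSup ((fun h' : ℝ => q μ' h' - h' ^ 2 / g) '' Set.Icc (-R) R) := by
    intro μ' hμ' h hh
    obtain ⟨hb, hbS, hmax, hsup⟩ := hB μ' hμ'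
    rw [hsup]
    exact hmax h hh
  -- all maximisers at `μ` share one `μ`-profile (`±h*` and evenness)
  obtain ⟨hstar, hst⟩ := huniq
  have huni : ∀ h ∈ Set.Icc (-R) R, ∀ h' ∈ Set.Icc (-R) R,
      q μ h - h ^ 2 / g = sSup ((fun h' : ℝ => q μ h' - h' ^ 2 / g) '' Set.Icc (-R) R) →
      q μ h' - h' ^ 2 / g = sSup ((fun h' : ℝ => q μ h' - h' ^ 2 / g) '' Set.Icc (-R) R) →
        ∀ μ' ∈ Set.Icc μ₁ μ₂, q μ' h = q μ' h' := by
    intro h hh h' hh' hmax hmax' μ' hμ'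
    rcases hst h hh hmax with rfl | rfl
    · rcases hst h' hh' hmax' with rfl | rfl
      · rfl
      · exact (heven μ' hμ' _ hh).symm
    · rcases hst h' hh' hmax' with rfl | rfl
      · exact heven μ' hμ' _ hh'
      · rfl
  exact nsg_noSplitAt_of_uniprofile
    (B := fun μ' => sSup ((fun h' : ℝ => q μ' h' - h' ^ 2 / g) '' Set.Icc (-R) R))
    g hLh hLμ hcvx hBup hBatt hμ huni hν

/-! ### The registered stub -/

/-- **GLUE `stub_noSplitGlue` (registered stub of skeleton v8.1, line `Sketch`): FLOOR + DEEP-UNIQ′ ⟹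
NoSplit.** With `a := min a₁ a₂`, `K' := max` and `U₀ := min` of the two data at that `a`: at an interior
`μ` every maximiser of the cold AHM payoff is deep (FLOOR), hence `±h*` (DEEP-UNIQ′), and
`nsg_noSplitAt_of_pm_uniq` (evenness + Lipschitz + convexity of the limit pressure, limits of maximisers
from the right and from the left, three-chord inequality) selects a maximiser carrying the given subgradient
of the envelope. [folklore composition] -/
theorem stub_noSplitGlue :
    (∀ (μ₁ μ₂ : ℝ), -4 < μ₁ → μ₁ < μ₂ → μ₂ < 0 → ∃ a₂ : ℝ, 0 < a₂ ∧ ∀ a ∈ Set.Ioc (0 : ℝ) a₂,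
      ∃ K' U₀ : ℝ, 0 < K' ∧ 0 < U₀ ∧ ∀ U ∈ Set.Ioc (0 : ℝ) U₀, ∀ g ∈ Set.Icc (K' * U) (1 / 10),
        ∀ q : ℝ → ℝ → ℝ,
          (∀ μ ∈ Set.Icc μ₁ μ₂, ∀ h ∈ Set.Icc (-(13 * g + 1)) (13 * g + 1), ∀ κ : ℝ, 0 < κ →
            ∃ L₀ : ℕ, ∀ (L : ℕ) [NeZero L], L₀ ≤ L →
              |Real.log (Matrix.partitionFn (Real.exp (a / U)) (dWaveSourceTorus L U μ h)).re /
                  (Real.exp (a / U) * (L : ℝ) ^ 2) - q μ h| ≤ κ) →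
          ∀ μ ∈ Set.Icc μ₁ μ₂, ∀ h ∈ Set.Icc (-(13 * g + 1)) (13 * g + 1),
            q μ h - h ^ 2 / g = sSup ((fun h' : ℝ => q μ h' - h' ^ 2 / g) '' Set.Icc (-(13 * g + 1)) (13 * g + 1)) →
              Real.exp (-(a / (4 * U))) ≤ |h|) →
    (∀ (μ₁ μ₂ : ℝ), -4 < μ₁ → μ₁ < μ₂ → μ₂ < 0 → ∃ a₁ : ℝ, 0 < a₁ ∧ ∀ a ∈ Set.Ioc (0 : ℝ) a₁,
      ∃ K' U₀ : ℝ, 0 < K' ∧ 0 < U₀ ∧ ∀ U ∈ Set.Ioc (0 : ℝ) U₀, ∀ g ∈ Set.Icc (K' * U) (1 / 10),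
        ∀ q : ℝ → ℝ → ℝ,
          (∀ μ ∈ Set.Icc μ₁ μ₂, ∀ h ∈ Set.Icc (-(13 * g + 1)) (13 * g + 1), ∀ κ : ℝ, 0 < κ →
            ∃ L₀ : ℕ, ∀ (L : ℕ) [NeZero L], L₀ ≤ L →
              |Real.log (Matrix.partitionFn (Real.exp (a / U)) (dWaveSourceTorus L U μ h)).re /
                  (Real.exp (a / U) * (L : ℝ) ^ 2) - q μ h| ≤ κ) →
          ∀ μ ∈ Set.Ioo μ₁ μ₂, ∃ hstar : ℝ, ∀ h ∈ Set.Icc (-(13 * g + 1)) (13 * g + 1),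
            Real.exp (-(a / (4 * U))) ≤ |h| →
            q μ h - h ^ 2 / g = sSup ((fun h' : ℝ => q μ h' - h' ^ 2 / g) '' Set.Icc (-(13 * g + 1)) (13 * g + 1)) →
              h = hstar ∨ h = -hstar) →
    ∀ (μ₁ μ₂ : ℝ), -4 < μ₁ → μ₁ < μ₂ → μ₂ < 0 → ∃ a K' U₀ : ℝ, 0 < a ∧ 0 < K' ∧ 0 < U₀ ∧
      ∀ U ∈ Set.Ioc (0 : ℝ) U₀, ∀ g ∈ Set.Icc (K' * U) (1 / 10), ∀ q : ℝ → ℝ → ℝ,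
        (∀ μ ∈ Set.Icc μ₁ μ₂, ∀ h ∈ Set.Icc (-(13 * g + 1)) (13 * g + 1), ∀ κ : ℝ, 0 < κ →
            ∃ L₀ : ℕ, ∀ (L : ℕ) [NeZero L], L₀ ≤ L →
              |Real.log (Matrix.partitionFn (Real.exp (a / U)) (dWaveSourceTorus L U μ h)).re /
                  (Real.exp (a / U) * (L : ℝ) ^ 2) - q μ h| ≤ κ) →
        ∀ μ ∈ Set.Ioo μ₁ μ₂, ∀ ν : ℝ,
          (∀ μ' ∈ Set.Icc μ₁ μ₂, sSup ((fun h' : ℝ => q μ h' - h' ^ 2 / g) '' Set.Icc (-(13 * g + 1)) (13 * g + 1)) + ν * (μ' - μ) ≤ sSup ((fun h' : ℝ => q μ' h' - h' ^ 2 / g) '' Set.Icc (-(13 * g + 1)) (13 * g + 1))) →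
          ∃ h₀ ∈ Set.Icc (-(13 * g + 1)) (13 * g + 1),
            q μ h₀ - h₀ ^ 2 / g = sSup ((fun h' : ℝ => q μ h' - h' ^ 2 / g) '' Set.Icc (-(13 * g + 1)) (13 * g + 1)) ∧
            ∀ μ' ∈ Set.Icc μ₁ μ₂, q μ h₀ + ν * (μ' - μ) ≤ q μ' h₀ := by
  -- bookkeeping adapted from `stub_deepGlue` (…RDeepGlue.lean)
  intro hF hUq μ₁ μ₂ h1 h12 h2
  obtain ⟨a₂, ha₂, hFa⟩ := hF μ₁ μ₂ h1 h12 h2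
  obtain ⟨a₁, ha₁, hUa⟩ := hUq μ₁ μ₂ h1 h12 h2
  set a : ℝ := min a₁ a₂ with ha_def
  have ha : 0 < a := lt_min ha₁ ha₂
  obtain ⟨KF, UF, hKF, hUF, hFmain⟩ := hFa a ⟨ha, min_le_right _ _⟩
  obtain ⟨KU, UU, hKU, hUU, hUmain⟩ := hUa a ⟨ha, min_le_left _ _⟩
  refine ⟨a, max KF KU, min UF UU, ha, lt_max_of_lt_left hKF, lt_min hUF hUU, ?_⟩
  intro U hU g hg q hq μ hμ ν hν
  have hUF' : U ∈ Set.Ioc (0 : ℝ) UF := ⟨hU.1, hU.2.trans (min_le_left _ _)⟩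
  have hUU' : U ∈ Set.Ioc (0 : ℝ) UU := ⟨hU.1, hU.2.trans (min_le_right _ _)⟩
  have hgF : g ∈ Set.Icc (KF * U) (1 / 10) :=
    ⟨(mul_le_mul_of_nonneg_right (le_max_left KF KU) hU.1.le).trans hg.1, hg.2⟩
  have hgU : g ∈ Set.Icc (KU * U) (1 / 10) :=
    ⟨(mul_le_mul_of_nonneg_right (le_max_right KF KU) hU.1.le).trans hg.1, hg.2⟩
  have hg0 : 0 < g := lt_of_lt_of_le (mul_pos hKU hU.1) hgU.1
  have hR : (0 : ℝ) ≤ 13 * g + 1 := by positivity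
  have hμW : μ ∈ Set.Icc μ₁ μ₂ := ⟨hμ.1.le, hμ.2.le⟩
  -- FLOOR makes every maximiser at `μ` deep, so DEEP-UNIQ′ applies to all of them
  obtain ⟨hstar, hst⟩ := hUmain U hUU' g hgU q hq μ hμ
  have huniq : ∃ hstar : ℝ, ∀ h ∈ Set.Icc (-(13 * g + 1)) (13 * g + 1),
      q μ h - h ^ 2 / g =
          sSup ((fun h' : ℝ => q μ h' - h' ^ 2 / g) '' Set.Icc (-(13 * g + 1)) (13 * g + 1)) →
        h = hstar ∨ h = -hstar :=
    ⟨hstar, fun h hh hmax => hst h hh (hFmain U hUF' g hgF q hq μ hμW h hh hmax) hmax⟩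
  exact nsg_noSplitAt_of_pm_uniq U (Real.exp (a / U)) g (13 * g + 1) μ₁ μ₂ (Real.exp_pos _) hR q hq hμ
    huniq hν

end

end Summit.HubbardSuperconductivity.HubbardSuperconductivity.Theorems.TwSeededEnsembleEquivalenceR.ColdFloorLine
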